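import Literature.MathematicalPhysics.QuantumFieldTheory.Balaban1983to89.UnitaryModel

/-!
# `BalabanImbrieJaffe1984to88.BIJ88Sect3Statements` — T. Bałaban, J. Imbrie, A. Jaffe, *Effective action and cluster
properties of the abelian Higgs model*, Commun. Math. Phys. **114** (1988) 257–315 [BalabanImbrieJaffe1988]:
Sect. 1 "Introduction" ((1.1)–(1.4): loop and string variables, the expectation, the clustering statement) and
Sect. 3 "The First Renormalization Step" ((3.1)–(3.4): unnormalized expectation, the action `S^ε(u, φ)` of the model,
the scalar potential; the lattice-set conventions `X*`, `X**`, `X^c` of p. 266; the rescaled constants (3.10), (3.12),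
(3.42)–(3.43); the first-step expansions (3.16)–(3.17), the Mayer identity (3.19)/(3.36) PROVED, the basic interaction
(3.23), the field strength (3.26), the small-field conditions (3.15), (3.32)–(3.33), the irrelevance bound (3.34)).

statement-level skeleton of published theorems with citation tags; proofs where landed; nothing here is a claim about the Yang–Mills mass gap

PDF held: `paper:balaban1988-cmp114-bij-abelian-higgs-effective-action` (journal page = PDF page + 256).  Renders read as
images (poppler, ×3): PDF pp. 2–3, 9–17 (journal 258–259, 265–273).

CITATION HEADER (lean-in-tree rule).  Part of the lit-balaban TYPED SKELETON (HOME `run/shared/lean/pub/lit-balaban/`; rows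
`C2.Eq1.1` … `C2.Eq3.44` of `HOME/lit-balaban-r18/ROWS-C2.md`; unit `lit-balaban-r18`, fold owner of C2 Sects. 1–4).
WHAT IS REPRODUCED, and how.  (a) CARRIERS: the periodic lattice `T_ε` is the torus `Balaban1983to89.Site P j` of `Balaban1983to89.Setup`
(bonds `PBond`, plaquettes `Plaq`); the compact abelian gauge field is `GaugeField P j U1`, `U1 = Matrix.unitaryGroup (Fin 1) ℂ`
(so that the product Haar measure `fieldMeasure` and `GaugeGroup.reTr` of the tree apply), read as complex numbers of modulus one
through `toC`; the scalar field is `φ : Balaban1983to89.Site P j → ℂ` with Lebesgue measure.  Observables, the action and the gauge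
transformations are written for ℂ-valued bond fields `u : PBond P j → ℂ` (the paper's `u(b) = exp(ieεA(b))`), the inverse
orientation being the complex conjugate.  (b) DEFINITIONS WITH BODIES: (1.1), (1.2), (3.1)–(3.4), p. 266 `X*`/`X**`, (3.10),
(3.12), (3.16)–(3.17) (as the printed splittings, the remainders DEFINED as remainders), (3.23), (3.26), (3.42)–(3.43).
(c) PROVED: the gauge invariance of the Wilson–Higgs action (3.3) asserted on p. 258 (`action_gauge`), the Mayer identity
(3.19) = (3.36) (`mayer_319`), the product form of (1.1) for `u = e^{iθ}` (`loopVar_phase`), `1 − Re u(p)` through the tree's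
`reTr ∘ plaqHol` (`plaqVar_cfg`), and the completed square `λ|φ|⁴ − ¼|φ|² + 1/(64λ) = λ(|φ|² − 1/(8λ))²` behind (3.4)/(4.5)
(`higgsP_eq_sq`); v1.1 (append-only): the loop variables (1.1) and string variables (1.2) ARE gauge invariant for closed / endpointed lattice curves (`IsPath`, `transport_gauge`, `loopVar_gauge`, `stringVar_gauge`); v1.2 (append-only, lead p36): the p. 267 remainder bound of (3.16) with the CORRECTED sign — `V0corr`/`W0corr`, `cos_taylor_remainder`, `abs_W0corr_le` (`|W₀| ≤ e₀^{n̄}|f|^{n̄+2}` for `e₀|f| ≤ 1`), `abs_W0corr_le_printed`, and the kernel witness `W0_printed_eq`/`V0_two` that the printed sign is a misprint; v1.3 (append-only, reading note GAPS G-C2-p36-04 of p36 gen 4): the CHARGE reading of `e^{n̄β}` in (3.34) as the primed statement `Ineq334c` (the charge `e` an explicit parameter) with `Ineq334c.toIneq334` (for `0 < e ≤ 1` it implies the `Real.exp` reading typed in `Ineq334`, which is thus the weaker statement).  (d) STATEMENTS as `def … : Prop` with explicit quantifier shape: (1.4) (uniformly in ε, over a family of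
observable algebras — the paper's GOAL, "expected", established for the unit lattice in [3] = Bałaban–Brydges–Imbrie–Jaffe 1984
and DEFERRED here: p. 259 *"A final cluster expansion will be performed on this theory in another paper, and the proof of
clustering and of the existence of the mass gap will then be complete"*), (3.5), (3.15), (3.32)–(3.34).  NOT typed (rows
`absent` with reasons in ROWS-C2.md): the densities (3.7), (3.11), (3.18), (3.20)–(3.22), (3.24)–(3.25), (3.27)–(3.31),
(3.37)–(3.41), (3.44) (bookkeeping displays over the regions Λ^{(0)}_0 … Λ^{(0)}_{13} and the U(1) block averages of [2, Chap. 2]).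
NOTHING of the paper is asserted beyond the kernel-checked identities listed under (c).
-/

namespace Literature.MathematicalPhysics.QuantumFieldTheory.BalabanImbrieJaffe1984to88.BIJ88Sect3Statements

open Literature.MathematicalPhysics.QuantumFieldTheory.Balaban1983to89
open scoped BigOperators
open MeasureTheory Complex

noncomputable section

/-! ## The U(1) carrier -/

/-- The gauge group `U(1)` of the abelian Higgs model (p. 258: *"a gauge theory on a lattice with spacing ε"*, (1.1)
`u(γ) = exp[Σ ieεA(b)]`), realised as `U(1) = Matrix.unitaryGroup (Fin 1) ℂ` so that the tree's `GaugeGroup`, `RegularGaugeGroup`,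
`HaarData` instances (`Balaban1983to89.UnitaryModel`) and `fieldMeasure` apply. [cite: BalabanImbrieJaffe1988, (1.1) p.258] -/
abbrev U1 : Type := Matrix.unitaryGroup (Fin 1) ℂ

/-- A `U(1)` element as a complex number of modulus one (its single matrix entry). [cite: BalabanImbrieJaffe1988, (1.1) p.258] -/
def toC (g : U1) : ℂ := (g : Matrix (Fin 1) (Fin 1) ℂ) 0 0

/-- kernel: `toC` is multiplicative. [cite: BalabanImbrieJaffe1988, (1.1) p.258] -/
theorem toC_mul (g h : U1) : toC (g * h) = toC g * toC h := by
  simp [toC, Matrix.mul_apply]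

/-- kernel: `toC 1 = 1`. [cite: BalabanImbrieJaffe1988, (1.1) p.258] -/
theorem toC_one : toC 1 = 1 := by
  simp [toC]

/-- kernel: the inverse orientation is the complex conjugate, `toC g⁻¹ = conj (toC g)`. [cite: BalabanImbrieJaffe1988, (1.1) p.258] -/
theorem toC_inv (g : U1) : toC g⁻¹ = (starRingEnd ℂ) (toC g) := by
  have h : ((g⁻¹ : U1) : Matrix (Fin 1) (Fin 1) ℂ) = star (g : Matrix (Fin 1) (Fin 1) ℂ) := by
    rw [← Unitary.star_eq_inv, Unitary.coe_star]
  simp [toC, h, Matrix.star_apply]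

/-- kernel: `|toC g| = 1`. [cite: BalabanImbrieJaffe1988, (1.1) p.258] -/
theorem norm_toC (g : U1) : ‖toC g‖ = 1 := by
  have h := Matrix.mem_unitaryGroup_iff.mp g.2
  have h00 := congrFun (congrFun h 0) 0
  simp only [Matrix.mul_apply, Fin.sum_univ_one, Matrix.star_apply, Matrix.one_apply_eq] at h00
  have h1 : ‖toC g‖ * ‖toC g‖ = 1 := by
    have := congrArg (fun z : ℂ => ‖z‖) h00
    simpa [toC, norm_mul] using this
  nlinarith [norm_nonneg (toC g)]

/-- kernel: the tree's normalized real trace on `U(1)` is the real part, `reTr g = Re (toC g)` — so the Wilson term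
"`1 − Re u(p)`" of (3.3) is `1 − reTr (plaqHol U p)`. [cite: BalabanImbrieJaffe1988, (3.3) p.265] -/
theorem reTr_eq (g : U1) : GaugeGroup.reTr g = (toC g).re := by
  show UnitaryModel.nReTr _ = _
  simp [UnitaryModel.nReTr, Matrix.trace, toC, QuantumLattice.unitaryFundamentalRep]

variable {P : Params} {j : ℕ}

/-- A `U(1)` configuration read as a ℂ-valued bond field `u(b)`, `|u(b)| = 1`. [cite: BalabanImbrieJaffe1988, (1.1) p.258] -/
def cfg (U : GaugeField P j U1) : PBond P j → ℂ := fun b => toC (U b)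

/-- The phase parametrization `u(b) = exp(iθ(b))` of a ℂ-valued bond field (the paper writes `θ = eεA`, (1.1), or `θ = e_kηA`,
(2.32)). [cite: BalabanImbrieJaffe1988, (1.1) p.258] -/
def phaseCfg (θ : PBond P j → ℝ) : PBond P j → ℂ := fun b => exp ((θ b : ℂ) * I)

/-! ## Sect. 1: observables, expectations, clustering -/

/-- An oriented lattice contour: a list of (positively oriented bond, orientation) pairs, `true` = traversed from `b₋` to
`b₊` (p. 258: *"γ is a closed curve on the lattice"*, *"Γ is a lattice curve from x to y"*; closedness / endpoints are not
part of the type). [cite: BalabanImbrieJaffe1988, (1.1) p.258] -/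
abbrev Contour (P : Params) (j : ℕ) : Type := List (PBond P j × Bool)

/-- The parallel transport of a ℂ-valued bond field along an oriented contour: the product of `u(b)` (positive orientation)
or `conj u(b)` (negative orientation). [cite: BalabanImbrieJaffe1988, (1.1) p.258] -/
def transport (u : PBond P j → ℂ) (γ : Contour P j) : ℂ :=
  (γ.map fun s => if s.2 then u s.1 else (starRingEnd ℂ) (u s.1)).prod

/-- **(1.1)** p. 258 [PDF 2], verbatim: *"Thus it is important to consider gauge invariant observables such as loop variables
u(γ) = exp[Σ_{b∈γ} ieεA(b)], (1.1) where γ is a closed curve on the lattice"* — for the compact field `u(b) = exp(ieεA(b))` this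
is the transport around `γ` (`loopVar_phase`). [cite: BalabanImbrieJaffe1988, (1.1) p.258] -/
def loopVar (u : PBond P j → ℂ) (γ : Contour P j) : ℂ := transport u γ

/-- The signed sum `Σ_{b∈γ} ±θ(b)` of a real bond field along an oriented contour (the exponent of (1.1)/(1.2)).
[cite: BalabanImbrieJaffe1988, (1.1) p.258] -/
def signedSum (θ : PBond P j → ℝ) (γ : Contour P j) : ℝ :=
  (γ.map fun s => if s.2 then θ s.1 else -θ s.1).sum

/-- kernel: the printed exponential form of (1.1) — for `u = e^{iθ}`, `u(γ) = exp[i Σ_{b∈γ} ±θ(b)]`.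
[cite: BalabanImbrieJaffe1988, (1.1) p.258] -/
theorem loopVar_phase (θ : PBond P j → ℝ) (γ : Contour P j) :
    loopVar (phaseCfg θ) γ = exp ((signedSum θ γ : ℂ) * I) := by
  induction γ with
  | nil => simp [loopVar, transport, signedSum]
  | cons s γ ih =>
    have ih' : transport (phaseCfg θ) γ = exp ((signedSum θ γ : ℂ) * I) := ih
    simp only [loopVar, transport, signedSum, List.map_cons, List.prod_cons, List.sum_cons] at ih' ⊢
    rw [ih']
    rcases s with ⟨b, sgn⟩
    cases sgn
    · simp only [phaseCfg, Bool.false_eq_true, ↓reduceIte, ← exp_conj, map_mul, conj_ofReal, conj_I, ← exp_add]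
      push_cast; ring_nf
    · simp only [phaseCfg, ↓reduceIte, ← exp_add]
      push_cast; ring_nf

/-- **(1.2)** p. 258 [PDF 2], verbatim: *"or string variables s(x, y, Γ) = \overline{φ(x)} exp(ieε Σ_{b∈Γ} A(b)) φ(y), (1.2)
where Γ is a lattice curve from x to y."* [cite: BalabanImbrieJaffe1988, (1.2) p.258] -/
def stringVar (u : PBond P j → ℂ) (φ : Balaban1983to89.Site P j → ℂ) (x y : Balaban1983to89.Site P j) (Γ : Contour P j) : ℂ :=
  (starRingEnd ℂ) (φ x) * transport u Γ * φ y

/-- **(3.1)** p. 265 [PDF 9], verbatim: *"We wish to give an expansion for the partition function, or for an unnormalized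
expectation of an observable F. Thus we consider [F] = ∫𝒟u𝒟φ e^{−S^ε(u,φ)}F, (3.1) where F is a gauge-invariant function, a
product of terms like |φ(x)|², \overline{φ}(b₋)u(b)φ(b₊), Re(ieε²)⁻¹(u(p) − 1)."* — `𝒟u` = product Haar measure on `U(1)^{bonds}`
(`fieldMeasure`; p. 274: *"The measure du^{(j)} is the normalized measure on U(1), ∫du^{(j)} = 1"*), `𝒟φ` = Lebesgue measure on
`ℂ^{sites}`; the action `S` is a parameter (the model's is `action`, (3.3)). [cite: BalabanImbrieJaffe1988, (3.1) p.265] -/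
def bracket (S : GaugeField P j U1 → (Balaban1983to89.Site P j → ℂ) → ℝ) (F : GaugeField P j U1 → (Balaban1983to89.Site P j → ℂ) → ℂ) : ℂ :=
  ∫ U, (∫ φ : Balaban1983to89.Site P j → ℂ, (Real.exp (-(S U φ)) : ℂ) * F U φ) ∂(fieldMeasure P j U1)

/-- **(3.2)** p. 265 [PDF 9] (= **(1.3)** p. 258, *"⟨B⟩ = Z⁻¹ ∫ e^{−S^ε}B(u,φ)𝒟u𝒟φ. (1.3) (We assume periodic boundary
conditions …)"*), verbatim: *"… in order to obtain ε-independent bounds on the full expectation ⟨F⟩ = [F]/[1]. (3.2)"*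
[cite: BalabanImbrieJaffe1988, (3.2) p.265] -/
def expect (S : GaugeField P j U1 → (Balaban1983to89.Site P j → ℂ) → ℝ) (F : GaugeField P j U1 → (Balaban1983to89.Site P j → ℂ) → ℂ) : ℂ :=
  bracket S F / bracket S fun _ _ => 1

/-- The gauge transformation of a ℂ-valued bond field by `λ : sites → ℝ`: `u(b) ↦ e^{iλ(b₋)} u(b) e^{−iλ(b₊)}` (p. 258: *"We use
the Wilson form of lattice action, which is gauge invariant"*; the tree's `GaugeField.gaugeAct` read through `toC`).
[cite: BalabanImbrieJaffe1988, (1.1) p.258] -/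
def gaugeU (lam : Balaban1983to89.Site P j → ℝ) (u : PBond P j → ℂ) : PBond P j → ℂ :=
  fun b => exp ((lam b.src : ℂ) * I) * u b * exp (-((lam b.tgt : ℂ) * I))

/-- The gauge transformation of the scalar field, `φ(x) ↦ e^{iλ(x)} φ(x)` (cf. (4.16) p. 276). [cite: BalabanImbrieJaffe1988, (4.16) p.276] -/
def gaugePhi (lam : Balaban1983to89.Site P j → ℝ) (φ : Balaban1983to89.Site P j → ℂ) : Balaban1983to89.Site P j → ℂ :=
  fun x => exp ((lam x : ℂ) * I) * φ x

/-- Gauge invariance of a function of `(u, φ)` (p. 258: *"gauge invariant observables"*, *"gauge invariant functions B, C"*).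
[cite: BalabanImbrieJaffe1988, (1.4) p.258] -/
def IsGaugeInvariant {α : Type*} (F : (PBond P j → ℂ) → (Balaban1983to89.Site P j → ℂ) → α) : Prop :=
  ∀ (lam : Balaban1983to89.Site P j → ℝ) (u : PBond P j → ℂ) (φ : Balaban1983to89.Site P j → ℂ), F (gaugeU lam u) (gaugePhi lam φ) = F u φ

/-- Abstract carrier for the clustering statement (1.4) at ONE lattice spacing: a type of (gauge invariant) observables with
their product, the equilibrium expectation `⟨·⟩` and the distance between supports `dist(B, C)` (p. 258).
[cite: BalabanImbrieJaffe1988, (1.4) p.258] -/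
structure ObsData where
  /-- observables `B`, `C`, … -/
  Obs : Type
  /-- the product `BC` -/
  mul : Obs → Obs → Obs
  /-- "gauge invariant functions" -/
  GaugeInv : Obs → Prop
  /-- the expectation (1.3) -/
  expect : Obs → ℂ
  /-- *"dist(B, C) denotes the distance between the supports of B and C"* -/
  dist : Obs → Obs → ℝ

/-- **(1.4)** p. 258 [PDF 2], verbatim: *"Thus for gauge invariant functions B, C we expect |⟨BC⟩ − ⟨B⟩⟨C⟩| ≦ O(1)exp[−m dist(B,C)],
(1.4) where 0 < m and dist(B, C) denotes the distance between the supports of B and C. For unit lattice models, (1.4) was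
established in [3] and here we investigate the corresponding estimates uniformly in the lattice spacing ε."* — typed UNIFORMLY over
a family `ι → ObsData` (ι = lattice spacings): ∃ m > 0 and O(1) BEFORE ε.  This is the series' GOAL; it is NOT proved in this paper
(p. 259: *"A final cluster expansion will be performed on this theory in another paper, and the proof of clustering and of the
existence of the mass gap will then be complete."*). [cite: BalabanImbrieJaffe1988, (1.4) p.258] -/
def Ineq14 {ι : Type*} (fam : ι → ObsData) : Prop :=
  ∃ m K : ℝ, 0 < m ∧ ∀ (i : ι) (B C : (fam i).Obs), (fam i).GaugeInv B → (fam i).GaugeInv C →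
    ‖(fam i).expect ((fam i).mul B C) - (fam i).expect B * (fam i).expect C‖ ≤ K * Real.exp (-m * (fam i).dist B C)

/-! ## Sect. 3: the action (3.3)–(3.4) -/

/-- The covariant derivative of the compact model, `(D^ε_u φ)(b) = ε⁻¹(u(b)φ(b₊) − φ(b₋))` (p. 265: *"Here −Δ^ε_u = D^{ε*}_u D^ε_u"*;
the terms *"\overline{φ}(b₋)u(b)φ(b₊)"* of (3.1)), at `c = ε⁻¹`. [cite: BalabanImbrieJaffe1988, (3.3) p.265] -/
def covD (c : ℝ) (u : PBond P j → ℂ) (φ : Balaban1983to89.Site P j → ℂ) : PBond P j → ℂ :=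
  fun b => (c : ℂ) * (u b * φ b.tgt - φ b.src)

/-- The plaquette variable `u(p) = u(b₁)u(b₂)\overline{u(b₃)}\,\overline{u(b₄)}` of a ℂ-valued bond field around
`p = ⟨x, x+e_μ, x+e_μ+e_ν, x+e_ν⟩` (the tree's `plaqHol` read through `toC`, `plaqVar_cfg`). [cite: BalabanImbrieJaffe1988, (3.3) p.265] -/
def plaqVar (u : PBond P j → ℂ) (p : Plaq P j) : ℂ :=
  u ⟨p.src, p.μ⟩ * u ⟨p.src.shift p.μ, p.ν⟩ * (starRingEnd ℂ) (u ⟨p.src.shift p.ν, p.μ⟩) * (starRingEnd ℂ) (u ⟨p.src, p.ν⟩)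

/-- kernel: for a `U(1)` configuration, `plaqVar (cfg U) p = toC (plaqHol U p)`, hence `Re u(p) = reTr (plaqHol U p)` (`reTr_eq`).
[cite: BalabanImbrieJaffe1988, (3.3) p.265] -/
theorem plaqVar_cfg (U : GaugeField P j U1) (p : Plaq P j) : plaqVar (cfg U) p = toC (GaugeField.plaqHol U p) := by
  simp [plaqVar, cfg, GaugeField.plaqHol, toC_mul, toC_inv]

/-- **(3.4)** p. 265 [PDF 9], verbatim: *"P(φ) = λ|φ|⁴ − ¼|φ|² + 1/(64λ) − ½δm²|φ|². (3.4)"* (p. 266: *"We have taken the bare scalar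
field mass [coming from the radial curvature of P(φ)] equal to 1 … We have included a mass renormalization δm² = δm²(e, λ, ε)"*).
[cite: BalabanImbrieJaffe1988, (3.4) p.265] -/
def higgsP (lam dm2 : ℝ) (z : ℂ) : ℝ :=
  lam * ‖z‖ ^ 4 - (1 / 4) * ‖z‖ ^ 2 + 1 / (64 * lam) - (1 / 2) * dm2 * ‖z‖ ^ 2

/-- kernel: the first three terms of (3.4) are the completed square `λ(|φ|² − 1/(8λ))²` — the potential has *"a pronounced ring
of minima at |φ| = ρ₀"* (p. 258) with `ρ₀ = (8λ)^{−1/2}`, the value subtracted in (4.5). [cite: BalabanImbrieJaffe1988, (3.4) p.265] -/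
theorem higgsP_eq_sq {lam : ℝ} (hlam : lam ≠ 0) (dm2 : ℝ) (z : ℂ) :
    higgsP lam dm2 z = lam * (‖z‖ ^ 2 - 1 / (8 * lam)) ^ 2 - (1 / 2) * dm2 * ‖z‖ ^ 2 := by
  unfold higgsP
  field_simp
  ring

/-- **(3.3)** p. 265 [PDF 9], verbatim: *"The action on T_ε, the ε-lattice, is S^ε(u,φ) = Σ_{p∈T_ε^{**}} ε^d (1/(e²ε⁴))[1 − Re u(p)]
+ ½⟨φ, −Δ^ε_u φ⟩ + Σ_{x∈T_ε} ε^d P(φ(x)) + E₀ + E₁. (3.3) Here −Δ^ε_u = D^{ε*}_u D^ε_u"* — with the weighted inner product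
`⟨φ, −Δ^ε_uφ⟩ = Σ_b ε^d |(D^ε_uφ)(b)|²`; parameters `w = ε^d`, `c = ε⁻¹`, the charge `e`, and the constants `E₀`, `E₁` of p. 266.
[cite: BalabanImbrieJaffe1988, (3.3) p.265] -/
def action (w c e lam dm2 E₀ E₁ : ℝ) (u : PBond P j → ℂ) (φ : Balaban1983to89.Site P j → ℂ) : ℝ :=
  (∑ p : Plaq P j, w * (c ^ 4 / e ^ 2) * (1 - (plaqVar u p).re)) +
    (1 / 2) * (∑ b : PBond P j, w * ‖covD c u φ b‖ ^ 2) + (∑ x : Balaban1983to89.Site P j, w * higgsP lam dm2 (φ x)) + E₀ + E₁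

/-- The model's action as a function of the `U(1)` configuration (the integrand of (3.1)). [cite: BalabanImbrieJaffe1988, (3.3) p.265] -/
def actionU1 (w c e lam dm2 E₀ E₁ : ℝ) (U : GaugeField P j U1) (φ : Balaban1983to89.Site P j → ℂ) : ℝ :=
  action w c e lam dm2 E₀ E₁ (cfg U) φ

/-- kernel (plumbing): `x + e_μ + e_ν = x + e_ν + e_μ` on the torus. [folklore] -/
private theorem shift_comm (x : Balaban1983to89.Site P j) (μ ν : Fin P.d) : (x.shift μ).shift ν = (x.shift ν).shift μ := by
  by_cases h : μ = ν
  · subst h; rfl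
  · funext κ
    by_cases h1 : κ = ν
    · subst h1; simp [Balaban1983to89.Site.shift, h, Ne.symm h]
    · by_cases h2 : κ = μ
      · subst h2; simp [Balaban1983to89.Site.shift, Function.update_apply, h1]
      · simp [Balaban1983to89.Site.shift, Function.update_apply, h1, h2]

/-- kernel (plumbing): `|e^{iλ}| = 1`. [folklore] -/
private theorem norm_phase (t : ℝ) : ‖exp ((t : ℂ) * I)‖ = 1 := by
  rw [mul_comm]; exact norm_exp_I_mul_ofReal t

/-- kernel: the covariant derivative is gauge COVARIANT, `D_{u^λ} φ^λ (b) = e^{iλ(b₋)} D_u φ (b)`. [cite: BalabanImbrieJaffe1988, (3.3) p.265] -/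
theorem covD_gauge (c : ℝ) (lam : Balaban1983to89.Site P j → ℝ) (u : PBond P j → ℂ) (φ : Balaban1983to89.Site P j → ℂ) (b : PBond P j) :
    covD c (gaugeU lam u) (gaugePhi lam φ) b = exp ((lam b.src : ℂ) * I) * covD c u φ b := by
  simp only [covD, gaugeU, gaugePhi]
  have h : exp (-((lam b.tgt : ℂ) * I)) * exp ((lam b.tgt : ℂ) * I) = 1 := by
    rw [← exp_add]; simp
  calc (c : ℂ) * (exp ((lam b.src : ℂ) * I) * u b * exp (-((lam b.tgt : ℂ) * I)) * (exp ((lam b.tgt : ℂ) * I) * φ b.tgt) -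
        exp ((lam b.src : ℂ) * I) * φ b.src)
        = (c : ℂ) * (exp ((lam b.src : ℂ) * I) * u b * (exp (-((lam b.tgt : ℂ) * I)) * exp ((lam b.tgt : ℂ) * I)) * φ b.tgt -
        exp ((lam b.src : ℂ) * I) * φ b.src) := by ring
    _ = _ := by rw [h]; ring

/-- kernel: the plaquette variable is gauge INVARIANT (abelian group). [cite: BalabanImbrieJaffe1988, (3.3) p.265] -/
theorem plaqVar_gauge (lam : Balaban1983to89.Site P j → ℝ) (u : PBond P j → ℂ) (p : Plaq P j) :
    plaqVar (gaugeU lam u) p = plaqVar u p := by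
  have hc : ((p.src.shift p.ν).shift p.μ) = ((p.src.shift p.μ).shift p.ν) := shift_comm p.src p.ν p.μ
  have e1 : ∀ t : ℝ, (starRingEnd ℂ) (exp ((t : ℂ) * I)) = exp (-((t : ℂ) * I)) := by
    intro t; rw [← exp_conj]; simp [conj_ofReal]
  have e2 : ∀ t : ℝ, (starRingEnd ℂ) (exp (-((t : ℂ) * I))) = exp ((t : ℂ) * I) := by
    intro t; rw [← exp_conj]; simp [conj_ofReal]
  have key : ∀ t : ℝ, exp ((t : ℂ) * I) * exp (-((t : ℂ) * I)) = 1 := by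
    intro t; rw [← exp_add]; simp
  simp only [plaqVar, gaugeU, PBond.tgt, map_mul, e1, e2, hc]
  set a := exp ((lam p.src : ℂ) * I) with ha
  set a' := exp (-((lam p.src : ℂ) * I)) with ha'
  set b := exp ((lam (p.src.shift p.μ) : ℂ) * I) with hb
  set b' := exp (-((lam (p.src.shift p.μ) : ℂ) * I)) with hb'
  set g := exp ((lam (p.src.shift p.ν) : ℂ) * I) with hg
  set g' := exp (-((lam (p.src.shift p.ν) : ℂ) * I)) with hg'
  set k := exp ((lam ((p.src.shift p.μ).shift p.ν) : ℂ) * I) with hk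
  set k' := exp (-((lam ((p.src.shift p.μ).shift p.ν) : ℂ) * I)) with hk'
  have h1 : a * a' = 1 := key _
  have h2 : b * b' = 1 := key _
  have h3 : g * g' = 1 := key _
  have h4 : k * k' = 1 := key _
  calc a * u ⟨p.src, p.μ⟩ * b' * (b * u ⟨p.src.shift p.μ, p.ν⟩ * k') *
        (g' * (starRingEnd ℂ) (u ⟨p.src.shift p.ν, p.μ⟩) * k) * (a' * (starRingEnd ℂ) (u ⟨p.src, p.ν⟩) * g)
        = (a * a') * (b * b') * (g * g') * (k * k') * (u ⟨p.src, p.μ⟩ * u ⟨p.src.shift p.μ, p.ν⟩ *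
          (starRingEnd ℂ) (u ⟨p.src.shift p.ν, p.μ⟩) * (starRingEnd ℂ) (u ⟨p.src, p.ν⟩)) := by ring
    _ = _ := by rw [h1, h2, h3, h4]; ring

/-- kernel: the potential term is gauge invariant (`|e^{iλ}φ| = |φ|`). [cite: BalabanImbrieJaffe1988, (3.4) p.265] -/
theorem higgsP_gauge (lam dm2 : ℝ) (g : Balaban1983to89.Site P j → ℝ) (φ : Balaban1983to89.Site P j → ℂ)
    (x : Balaban1983to89.Site P j) : higgsP lam dm2 (gaugePhi g φ x) = higgsP lam dm2 (φ x) := by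
  simp [higgsP, gaugePhi]

/-- kernel: **the Wilson–Higgs action (3.3) is gauge invariant** (p. 258: *"We use the Wilson form of lattice action, which is
gauge invariant"*). [cite: BalabanImbrieJaffe1988, (3.3) p.265] -/
theorem action_gauge (w c e lam dm2 E₀ E₁ : ℝ) : IsGaugeInvariant (P := P) (j := j) (action w c e lam dm2 E₀ E₁) := by
  intro g u φ
  simp only [action, plaqVar_gauge, covD_gauge, norm_mul, norm_phase, one_mul, higgsP_gauge]

/-- **(3.5)** p. 266 [PDF 10], verbatim: *"The constant E₀ = E₀(ε, T_ε) normalizes the integral (3.1) so that lim_{λ,e→0} [1] = 1.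
(3.5)"* — over the normalization `[1]` as a function of `(λ, e)`, the limit taken within `λ > 0, e > 0`.
[cite: BalabanImbrieJaffe1988, (3.5) p.266] -/
def Eq35 (one : ℝ × ℝ → ℂ) : Prop :=
  Filter.Tendsto one (nhdsWithin (0, 0) {q | 0 < q.1 ∧ 0 < q.2}) (nhds 1)

/-! ## Sect. 3: lattice-set conventions (p. 266) -/

/-- p. 266 [PDF 10], verbatim: *"We denote by X* the set of bonds with both endpoints in X"* (p. 267: *"Λ* denotes the bonds with
both endpoints in Λ"*; ℤᵈ analogues in the tree: `B7BlockGeometry.bondsIn`, `B6FaceInterpolation.bondsIn`).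
[cite: BalabanImbrieJaffe1988, (3.5) p.266] -/
def starB (X : Finset (Balaban1983to89.Site P j)) : Finset (PBond P j) :=
  Finset.univ.filter fun b => b.src ∈ X ∧ b.tgt ∈ X

/-- p. 266 [PDF 10], verbatim: *"then X** denotes the set of plaquettes with all four corners in X"*.
[cite: BalabanImbrieJaffe1988, (3.5) p.266] -/
def starP (X : Finset (Balaban1983to89.Site P j)) : Finset (Plaq P j) :=
  Finset.univ.filter fun p => p.src ∈ X ∧ p.src.shift p.μ ∈ X ∧ p.src.shift p.ν ∈ X ∧ (p.src.shift p.μ).shift p.ν ∈ X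

/-- kernel: membership in `X*`. [cite: BalabanImbrieJaffe1988, (3.5) p.266] -/
theorem mem_starB (X : Finset (Balaban1983to89.Site P j)) (b : PBond P j) : b ∈ starB X ↔ b.src ∈ X ∧ b.tgt ∈ X := by
  simp [starB]

/-- kernel, p. 266 verbatim: *"A superscript c denotes complement, so that X^c = T^{(k)}_a∖X, X^{*c} = T^{(k)*}_a∖X*, etc. Thus
X^{c*c} includes bonds with one or both endpoints in X"* — indeed `X^{c*c}` is EXACTLY the set of such bonds.
[cite: BalabanImbrieJaffe1988, (3.5) p.266] -/
theorem not_mem_starB_compl (X : Finset (Balaban1983to89.Site P j)) (b : PBond P j) :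
    b ∉ starB Xᶜ ↔ b.src ∈ X ∨ b.tgt ∈ X := by
  simp only [mem_starB, Finset.mem_compl, not_and_or, not_not]

/-! ## Sect. 3: rescaled constants and first-step objects -/

/-- **(3.10)** p. 266 [PDF 10], verbatim: *"The constant ℰ₀ includes the scaling factors, ℰ₀ = E₀ − (d−2)|T₁| log ε⁻¹. (3.10)"*
(`cardT1` = |T₁|, the number of sites). [cite: BalabanImbrieJaffe1988, (3.10) p.266] -/
def calE0 (E₀ : ℝ) (d : ℕ) (cardT1 : ℕ) (ε : ℝ) : ℝ := E₀ - ((d : ℝ) - 2) * cardT1 * Real.log ε⁻¹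

/-- **(3.12)** p. 267 [PDF 11], verbatim: *"Here we define E^{(0)} = −|T₁^{(1)}| log(aL^{d−2}/2π), (3.12) which normalizes the
transformation so that [F] = ∫dv dψ ρ₁^L(v, ψ). (3.13)"* [cite: BalabanImbrieJaffe1988, (3.12) p.267] -/
def E0step (cardT11 : ℕ) (a L : ℝ) (d : ℕ) : ℝ := -(cardT11 : ℝ) * Real.log (a * L ^ (d - 2) / (2 * Real.pi))

/-- **(3.42)** p. 273 [PDF 17], verbatim: *"From the block field ψ we get a contribution to the normalization energy:
E^{(0)′} = (d−2)(log L)|T₁^{(1)}|, (3.42)"* [cite: BalabanImbrieJaffe1988, (3.42) p.273] -/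
def E0prime (d : ℕ) (L : ℝ) (cardT11 : ℕ) : ℝ := ((d : ℝ) - 2) * Real.log L * cardT11

/-- **(3.43)** p. 273 [PDF 17], verbatim: *"and we put ℰ₁ = ℰ₀ + E^{(0)} + E^{(0)′}. (3.43)"* [cite: BalabanImbrieJaffe1988, (3.43) p.273] -/
def calE1 (calE₀ E0s E0p : ℝ) : ℝ := calE₀ + E0s + E0p

/-- **(3.26)** p. 269 [PDF 13], verbatim: *"f(p) = (ie₀)⁻¹ log v(p). (3.26)"* (also (3.15) `f^{(0)}(p) = (ie₀)⁻¹ log u(p)`, p. 261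
`f^{(k)}(p) = (ie_k)⁻¹ log u(p)`, (4.13)): the field strength of a plaquette variable, principal branch of `log`.
[cite: BalabanImbrieJaffe1988, (3.26) p.269] -/
def fieldStrength (e₀ : ℝ) (v : ℂ) : ℂ := (I * e₀)⁻¹ * log v

/-- **(3.16)** p. 267 [PDF 11], the polynomial part, verbatim: *"e₀⁻²[1 − Re u(p)] = ½f^{(0)}(p)² + Σ_{n=2}^{n̄/2} (−1)ⁿ
e₀^{2n−2}(f^{(0)}(p))^{2n}/(2n)! + W₀(p) = ½f^{(0)}(p)² + V₀(p) + W₀(p). (3.16)"* — `V₀` AS PRINTED, sign `(−1)ⁿ` included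
(TRANSCRIPTION NOTE: the Taylor series of `e₀⁻²(1 − cos e₀f)` has `(−1)^{n+1}`; the row records the display verbatim),
upper limit `nhalf = n̄/2`. [cite: BalabanImbrieJaffe1988, (3.16) p.267] -/
def V0 (e₀ : ℝ) (nhalf : ℕ) (f : ℝ) : ℝ :=
  ∑ n ∈ Finset.Icc 2 nhalf, (-1) ^ n * e₀ ^ (2 * n - 2) * f ^ (2 * n) / (2 * n).factorial

/-- **(3.16)**, the remainder `W₀(p)`: DEFINED as `e₀⁻²[1 − Re u(p)] − ½f² − V₀` (p. 267: *"the remainder is called 'irrelevant'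
because it is bounded by ce₀^{n̄}p(e₀)^{n̄+2} ≦ eε^{d+1} for n̄ large enough"* — that bound is not typed).
[cite: BalabanImbrieJaffe1988, (3.16) p.267] -/
def W0 (e₀ : ℝ) (nhalf : ℕ) (reu f : ℝ) : ℝ := e₀⁻¹ ^ 2 * (1 - reu) - (1 / 2) * f ^ 2 - V0 e₀ nhalf f

/-- kernel: (3.16) holds with `W₀` so defined. [cite: BalabanImbrieJaffe1988, (3.16) p.267] -/
theorem eq316 (e₀ : ℝ) (nhalf : ℕ) (reu f : ℝ) :
    e₀⁻¹ ^ 2 * (1 - reu) = (1 / 2) * f ^ 2 + V0 e₀ nhalf f + W0 e₀ nhalf reu f := by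
  unfold W0; ring

/-- **(3.17)** p. 267 [PDF 11], verbatim: *"For factors (ieε²)⁻¹(u(p)−1) = (ie₀)⁻¹ε^{−d/2}(u(p)−1) in the observable F, p ∈ Λ₀^{(0)**},
we expand: (ie(ε))⁻¹ε^{−d/2}(u(p)−1) = Σ_{n=1}^∞ ε^{−d/2}((ie₀)^{n−1}/n!)(f₀(p))ⁿ = F_rel(p) + F_irr(p). (3.17) The first three
terms are relevant … The others are included in F_irr(p)."* — `F_rel` = the terms n = 1, 2, 3. [cite: BalabanImbrieJaffe1988, (3.17) p.267] -/
def Frel (ε e₀ : ℝ) (d : ℕ) (f₀ : ℂ) : ℂ :=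
  ∑ n ∈ Finset.Icc 1 3, ((ε ^ (-(d : ℝ) / 2) : ℝ) : ℂ) * ((I * e₀) ^ (n - 1) / n.factorial) * f₀ ^ n

/-- **(3.17)**, `F_irr(p)`: DEFINED as the left side minus `F_rel(p)`. [cite: BalabanImbrieJaffe1988, (3.17) p.267] -/
def Firr (ε e₀ : ℝ) (d : ℕ) (u f₀ : ℂ) : ℂ :=
  (I * e₀)⁻¹ * ((ε ^ (-(d : ℝ) / 2) : ℝ) : ℂ) * (u - 1) - Frel ε e₀ d f₀

/-- kernel: (3.17) holds with `F_irr` so defined. [cite: BalabanImbrieJaffe1988, (3.17) p.267] -/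
theorem eq317 (ε e₀ : ℝ) (d : ℕ) (u f₀ : ℂ) :
    (I * e₀)⁻¹ * ((ε ^ (-(d : ℝ) / 2) : ℝ) : ℂ) * (u - 1) = Frel ε e₀ d f₀ + Firr ε e₀ d u f₀ := by
  unfold Firr; ring

/-- **(3.19)** p. 268 [PDF 12], verbatim: *"The irrelevant part of the gauge field action is Mayer-expanded:
exp[−Σ_{p∈Λ₀^{(0)**}} W₀(p)] = Σ_{S_p⊂Λ₀^{(0)**}} Π_{p∈S_p} (e^{−W₀(p)} − 1). (3.19)"* — PROVED (also **(3.36)** p. 271,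
*"exp(−Σ_□ W₄^{(0)}(□)) = Σ_{S₄} Π_{□∈S₄} (exp(−W₄^{(0)}(□)) − 1). (3.36)"*, the same identity over cubes).
[cite: BalabanImbrieJaffe1988, (3.19) p.268] -/
theorem mayer_319 {α : Type*} (Λ : Finset α) (W : α → ℝ) :
    Real.exp (-∑ p ∈ Λ, W p) = ∑ S ∈ Λ.powerset, ∏ p ∈ S, (Real.exp (-W p) - 1) := by
  rw [← Finset.prod_one_add, ← Finset.sum_neg_distrib, Real.exp_sum]
  exact Finset.prod_congr rfl fun p _ => by ring

/-- **(3.23)** p. 269 [PDF 13], verbatim: *"where the basic interaction terms have been included in 𝒫_{0,loc}(Λ₀^{(0)}) =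
Σ_{x∈Λ₀^{(0)}} (P₀(φ(x)) + ½δm²ε²|φ(x)|² + E₁(x)) + Σ_{p∈Λ₀^{(0)**}} V₀(p). (3.23)"* — over the data `P₀` (the potential (3.8) at
k = 0, `BIJ88Sect4Statements.Pk`), `E₁(x)` (p. 268: *"E₁ = Σ_x E₁(x), E₁(x) defined by fixing one vertex at x"*), `V₀(p)`.
[cite: BalabanImbrieJaffe1988, (3.23) p.269] -/
def P0loc (P₀ : ℂ → ℝ) (dm2 ε : ℝ) (E₁ : Balaban1983to89.Site P j → ℝ) (V₀ : Plaq P j → ℝ) (φ : Balaban1983to89.Site P j → ℂ) (Λ : Finset (Balaban1983to89.Site P j)) : ℝ :=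
  (∑ x ∈ Λ, (P₀ (φ x) + (1 / 2) * dm2 * ε ^ 2 * ‖φ x‖ ^ 2 + E₁ x)) + ∑ p ∈ starP Λ, V₀ p

/-! ## Sect. 3: small-field conditions and the irrelevance bound -/

/-- **(3.15)** p. 267 [PDF 11], verbatim: *"Here Λ₀^{(0)} ⊂ T₁ is the small field region. It is composed of r(e₀)-cubes, in each of
which the factor χ_{Λ₀^{(0)}} enforces the following conditions: |D_uφ| ≦ p(e₀), |ψ − Q(u)φ| ≦ p(e₀), |φ| ≦ λ₀^{−1/4}p(e₀),
|f^{(0)}(p)| ≦ p(e₀), where f^{(0)}(p) = (ie₀)⁻¹ log u(p). (3.15)"* — as a predicate on the VALUES of the four fields over the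
region (sites `Λ`, its bonds `Λ*`, plaquettes `Λ**`, block sites `Λ'`), the block average `Q(u)φ` entering as data `Qφ`.
[cite: BalabanImbrieJaffe1988, (3.15) p.267] -/
def SmallField315 (pe₀ lam₀ : ℝ) (Λ : Finset (Balaban1983to89.Site P j)) (Λ' : Finset (Balaban1983to89.Site P (j + 1))) (Dφ : PBond P j → ℂ)
    (ψ Qφ : Balaban1983to89.Site P (j + 1) → ℂ) (φ : Balaban1983to89.Site P j → ℂ) (f0 : Plaq P j → ℝ) : Prop :=
  (∀ b ∈ starB Λ, ‖Dφ b‖ ≤ pe₀) ∧ (∀ y ∈ Λ', ‖ψ y - Qφ y‖ ≤ pe₀) ∧ (∀ x ∈ Λ, ‖φ x‖ ≤ lam₀ ^ (-(1 / 4 : ℝ)) * pe₀) ∧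
    ∀ p ∈ starP Λ, |f0 p| ≤ pe₀

/-- **(3.32)** p. 270 [PDF 14], verbatim: *"In the small field region Λ₀^{(0)} we have small block fields: |v(p) − 1| ≦ ce₀p(e₀),
|ψ(y)| ≦ cp(e₀)λ₀^{−1/4}, |(D_{ū₁}ψ)(b′)| ≦ cp(e₀), b′ ∈ Λ₀^{(0)′*}, (3.32) where ū₁(b′) = ū₁(⟨b′₋, b′₊⟩)"* — over the block
lattice (level j+1) region `Λ'` with its bonds and plaquettes. [cite: BalabanImbrieJaffe1988, (3.32) p.270] -/
def SmallBlock332 (c e₀ pe₀ lam₀ : ℝ) (Λ' : Finset (Balaban1983to89.Site P (j + 1))) (v : Plaq P (j + 1) → ℂ) (ψ : Balaban1983to89.Site P (j + 1) → ℂ)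
    (Dψ : PBond P (j + 1) → ℂ) : Prop :=
  (∀ p ∈ starP Λ', ‖v p - 1‖ ≤ c * e₀ * pe₀) ∧ (∀ y ∈ Λ', ‖ψ y‖ ≤ c * pe₀ * lam₀ ^ (-(1 / 4 : ℝ))) ∧
    ∀ b ∈ starB Λ', ‖Dψ b‖ ≤ c * pe₀

/-- **(3.33)** p. 270 [PDF 14], verbatim: *"Similarly, it can be shown that |A^{(0)}| ≦ cp(e₀) in Λ₁^{(0)*}, |φ^{(0)}| ≦ cp(e₀) in
Λ₁^{(0)*} [sic], (3.33) and we inset [sic] a factor χ′_{Λ₇^{(0)}} enforcing these bounds in Λ₇^{(0)}."* (second membership printed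
with a star; typed over the sites of the region). [cite: BalabanImbrieJaffe1988, (3.33) p.270] -/
def Small333 (c pe₀ : ℝ) (Λ : Finset (Balaban1983to89.Site P j)) (A0 : PBond P j → ℝ) (φ0 : Balaban1983to89.Site P j → ℂ) : Prop :=
  (∀ b ∈ starB Λ, |A0 b| ≤ c * pe₀) ∧ ∀ x ∈ Λ, ‖φ0 x‖ ≤ c * pe₀

/-- **(3.34)** p. 270 [PDF 14], verbatim: *"The other terms are written as Σ_□ W₃^{(0)}(□), each term localized at an r(e₀)-cube,
and we have a bound |W₃^{(0)}(□)| ≦ e^{n̄β}(ε/ε₀)^κ. (3.34) Here β > 0 is a fixed small power, κ > d is a fixed large power, and ε₀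
is the lattice spacing to terminate the induction. ε₀ = ε^β min{1, (8λ/e²)^{1/2}}. (3.35)"* — (3.35) is typed as
`BIJ88Sect4Statements.eps0` in the form printed on p. 273 (`e^β`; the `ε^β` of (3.35) is recorded there as a variant).
[cite: BalabanImbrieJaffe1988, (3.34) p.270] -/
def Ineq334 {Cube : Type*} (nbar : ℕ) (β ε ε₀ κ : ℝ) (W₃ : Cube → ℝ) : Prop :=
  ∀ q : Cube, |W₃ q| ≤ Real.exp (nbar * β) * (ε / ε₀) ^ κ

/-! ## v1.1 (append-only): the observables (1.1)–(1.2) ARE gauge invariant (p. 258) -/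

/-- The initial and final site of an oriented bond `(b, ±)`: `+` runs from `b₋` to `b₊`, `−` from `b₊` to `b₋`.
[cite: BalabanImbrieJaffe1988, (1.1) p.258] -/
def segStart (s : PBond P j × Bool) : Balaban1983to89.Site P j := if s.2 then s.1.src else s.1.tgt

/-- The final site of an oriented bond. [cite: BalabanImbrieJaffe1988, (1.1) p.258] -/
def segEnd (s : PBond P j × Bool) : Balaban1983to89.Site P j := if s.2 then s.1.tgt else s.1.src

/-- `IsPath x γ y`: the oriented contour `γ` is *"a lattice curve from x to y"* (p. 258) — consecutive oriented bonds match
head to tail; `IsPath x γ x` = *"γ is a closed curve on the lattice"*. [cite: BalabanImbrieJaffe1988, (1.2) p.258] -/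
def IsPath : Balaban1983to89.Site P j → Contour P j → Balaban1983to89.Site P j → Prop
  | x, [], y => x = y
  | x, s :: γ, y => segStart s = x ∧ IsPath (segEnd s) γ y

/-- kernel: the transport along a curve from `x` to `y` is gauge COVARIANT, `u^λ(Γ) = e^{iλ(x)} u(Γ) e^{−iλ(y)}` (telescoping of
the bond phases). [cite: BalabanImbrieJaffe1988, (1.2) p.258] -/
theorem transport_gauge (lam : Balaban1983to89.Site P j → ℝ) (u : PBond P j → ℂ) :
    ∀ (γ : Contour P j) (x y : Balaban1983to89.Site P j), IsPath x γ y →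
      transport (gaugeU lam u) γ = exp ((lam x : ℂ) * I) * transport u γ * exp (-((lam y : ℂ) * I))
  | [], x, y, h => by
    cases h
    simp only [transport, List.map_nil, List.prod_nil, mul_one, ← exp_add]
    simp
  | s :: γ, x, y, h => by
    obtain ⟨hs, hγ⟩ := h
    have ih := transport_gauge lam u γ (segEnd s) y hγ
    have key : ∀ t : ℝ, exp (-((t : ℂ) * I)) * exp ((t : ℂ) * I) = 1 := by
      intro t; rw [← exp_add]; simp
    have e1 : ∀ t : ℝ, (starRingEnd ℂ) (exp ((t : ℂ) * I)) = exp (-((t : ℂ) * I)) := by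
      intro t; rw [← exp_conj]; simp [conj_ofReal]
    have e2 : ∀ t : ℝ, (starRingEnd ℂ) (exp (-((t : ℂ) * I))) = exp ((t : ℂ) * I) := by
      intro t; rw [← exp_conj]; simp [conj_ofReal]
    simp only [transport, List.map_cons, List.prod_cons] at ih ⊢
    rw [ih]
    rcases s with ⟨b, sgn⟩
    cases sgn
    · -- negative orientation: from b₊ to b₋, factor conj u^λ(b) = e^{iλ(b₊)} conj u(b) e^{−iλ(b₋)}
      simp only [segStart, segEnd, Bool.false_eq_true, ↓reduceIte] at hs ⊢
      subst hs
      simp only [gaugeU, map_mul, e1, e2]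
      calc exp (-((lam b.src : ℂ) * I)) * (starRingEnd ℂ) (u b) * exp ((lam b.tgt : ℂ) * I) *
            (exp ((lam b.src : ℂ) * I) * (List.map (fun s => if s.2 = true then u s.1 else (starRingEnd ℂ) (u s.1)) γ).prod *
              exp (-((lam y : ℂ) * I)))
            = (exp (-((lam b.src : ℂ) * I)) * exp ((lam b.src : ℂ) * I)) * (exp ((lam b.tgt : ℂ) * I) *
              ((starRingEnd ℂ) (u b) * (List.map (fun s => if s.2 = true then u s.1 else (starRingEnd ℂ) (u s.1)) γ).prod) *
              exp (-((lam y : ℂ) * I))) := by ring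
        _ = _ := by rw [key, one_mul]
    · -- positive orientation: from b₋ to b₊, factor u^λ(b) = e^{iλ(b₋)} u(b) e^{−iλ(b₊)}
      simp only [segStart, segEnd, ↓reduceIte] at hs ⊢
      subst hs
      simp only [gaugeU]
      calc exp ((lam b.src : ℂ) * I) * u b * exp (-((lam b.tgt : ℂ) * I)) *
            (exp ((lam b.tgt : ℂ) * I) * (List.map (fun s => if s.2 = true then u s.1 else (starRingEnd ℂ) (u s.1)) γ).prod *
              exp (-((lam y : ℂ) * I)))
            = (exp (-((lam b.tgt : ℂ) * I)) * exp ((lam b.tgt : ℂ) * I)) * (exp ((lam b.src : ℂ) * I) *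
              (u b * (List.map (fun s => if s.2 = true then u s.1 else (starRingEnd ℂ) (u s.1)) γ).prod) *
              exp (-((lam y : ℂ) * I))) := by ring
        _ = _ := by rw [key, one_mul]

/-- kernel: **loop variables (1.1) are gauge invariant** — for a CLOSED curve `γ` (from `x` back to `x`), `u^λ(γ) = u(γ)` (p. 258:
*"gauge invariant observables such as loop variables"*). [cite: BalabanImbrieJaffe1988, (1.1) p.258] -/
theorem loopVar_gauge (lam : Balaban1983to89.Site P j → ℝ) (u : PBond P j → ℂ) {γ : Contour P j}
    {x : Balaban1983to89.Site P j} (hγ : IsPath x γ x) : loopVar (gaugeU lam u) γ = loopVar u γ := by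
  have h := transport_gauge lam u γ x x hγ
  have key : exp ((lam x : ℂ) * I) * exp (-((lam x : ℂ) * I)) = 1 := by rw [← exp_add]; simp
  simp only [loopVar, h]
  calc exp ((lam x : ℂ) * I) * transport u γ * exp (-((lam x : ℂ) * I))
      = (exp ((lam x : ℂ) * I) * exp (-((lam x : ℂ) * I))) * transport u γ := by ring
    _ = transport u γ := by rw [key, one_mul]

/-- kernel: **string variables (1.2) are gauge invariant** — for `Γ` a lattice curve from `x` to `y`,
`s^λ(x, y, Γ) = \overline{e^{iλ(x)}φ(x)} e^{iλ(x)}u(Γ)e^{−iλ(y)} e^{iλ(y)}φ(y) = s(x, y, Γ)` (p. 258: *"gauge invariant observables such as …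
string variables"*). [cite: BalabanImbrieJaffe1988, (1.2) p.258] -/
theorem stringVar_gauge (lam : Balaban1983to89.Site P j → ℝ) (u : PBond P j → ℂ) (φ : Balaban1983to89.Site P j → ℂ)
    {Γ : Contour P j} {x y : Balaban1983to89.Site P j} (hΓ : IsPath x Γ y) :
    stringVar (gaugeU lam u) (gaugePhi lam φ) x y Γ = stringVar u φ x y Γ := by
  have h := transport_gauge lam u Γ x y hΓ
  have e1 : (starRingEnd ℂ) (exp ((lam x : ℂ) * I)) = exp (-((lam x : ℂ) * I)) := by
    rw [← exp_conj]; simp [conj_ofReal]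
  have k1 : exp (-((lam x : ℂ) * I)) * exp ((lam x : ℂ) * I) = 1 := by rw [← exp_add]; simp
  have k2 : exp (-((lam y : ℂ) * I)) * exp ((lam y : ℂ) * I) = 1 := by rw [← exp_add]; simp
  simp only [stringVar, gaugePhi, h, map_mul, e1]
  calc exp (-((lam x : ℂ) * I)) * (starRingEnd ℂ) (φ x) *
        (exp ((lam x : ℂ) * I) * transport u Γ * exp (-((lam y : ℂ) * I))) * (exp ((lam y : ℂ) * I) * φ y)
      = (exp (-((lam x : ℂ) * I)) * exp ((lam x : ℂ) * I)) * (exp (-((lam y : ℂ) * I)) * exp ((lam y : ℂ) * I)) *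
        ((starRingEnd ℂ) (φ x) * transport u Γ * φ y) := by ring
    _ = _ := by rw [k1, k2, one_mul, one_mul]

/-! ## v1.2 (append-only): the remainder bound of (3.16) p. 267 with the corrected sign (lead PHASE2-TARGETS p36) -/

/-- (3.16) with the sign CORRECTED per transcript note T1 (the Taylor series of `e₀⁻²(1 − cos e₀f)` alternates starting with `+½f²`):
`V₀^{corr}(p) = Σ_{n=2}^{n̄/2} (−1)^{n+1} e₀^{2n−2}(f^{(0)}(p))^{2n}/(2n)!` — NOT the printed polynomial (`V0` is the printed one; `V0corr_eq_neg_V0`).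
[cite: BalabanImbrieJaffe1988, (3.16) p.267] -/
def V0corr (e₀ : ℝ) (nhalf : ℕ) (f : ℝ) : ℝ :=
  ∑ n ∈ Finset.Icc 2 nhalf, (-1) ^ (n + 1) * e₀ ^ (2 * n - 2) * f ^ (2 * n) / (2 * n).factorial

/-- The remainder `W₀` of (3.16) for the Wilson term `e₀⁻²[1 − Re u(p)] = e₀⁻²(1 − cos(e₀f))` (`u(p) = e^{ie₀f(p)}`, f real) with the
corrected polynomial: `W₀^{corr} = e₀⁻²(1 − cos e₀f) − ½f² − V₀^{corr}`. [cite: BalabanImbrieJaffe1988, (3.16) p.267] -/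
def W0corr (e₀ : ℝ) (nhalf : ℕ) (f : ℝ) : ℝ :=
  e₀⁻¹ ^ 2 * (1 - Real.cos (e₀ * f)) - (1 / 2) * f ^ 2 - V0corr e₀ nhalf f

/-- kernel: the corrected polynomial is MINUS the printed one. [cite: BalabanImbrieJaffe1988, (3.16) p.267] -/
theorem V0corr_eq_neg_V0 (e₀ : ℝ) (nhalf : ℕ) (f : ℝ) : V0corr e₀ nhalf f = -V0 e₀ nhalf f := by
  simp only [V0corr, V0, ← Finset.sum_neg_distrib]
  refine Finset.sum_congr rfl fun n _ => ?_
  rw [pow_succ]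
  ring

/-- kernel WITNESS (lead p36): with the PRINTED sign, the remainder `W₀` of (3.16) (at `Re u(p) = cos e₀f`) differs from the true Taylor
remainder by twice the polynomial, `W₀^{printed} = W₀^{corr} − 2V₀` — a term of order `e₀²f⁴` (`V0_two`), NOT `O(e₀^{n̄})`; so the printed
`(−1)ⁿ` is a misprint for `(−1)^{n+1}`. [cite: BalabanImbrieJaffe1988, (3.16) p.267] -/
theorem W0_printed_eq (e₀ : ℝ) (nhalf : ℕ) (f : ℝ) :
    W0 e₀ nhalf (Real.cos (e₀ * f)) f = W0corr e₀ nhalf f - 2 * V0 e₀ nhalf f := by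
  simp only [W0, W0corr, V0corr_eq_neg_V0]
  ring

/-- kernel: the first printed coefficient, `V₀ = e₀²f⁴/24` at `n̄/2 = 2`. [cite: BalabanImbrieJaffe1988, (3.16) p.267] -/
theorem V0_two (e₀ f : ℝ) : V0 e₀ 2 f = e₀ ^ 2 * f ^ 4 / 24 := by
  norm_num [V0, Nat.factorial]

/-- kernel (plumbing): the real part of the even-length partial sums of `exp(iθ)` is the cosine Taylor polynomial. [folklore] -/
private theorem re_exp_partial (θ : ℝ) : ∀ K : ℕ,
    (∑ m ∈ Finset.range (2 * K), ((θ : ℂ) * I) ^ m / m.factorial).re =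
      ∑ n ∈ Finset.range K, (-1) ^ n * θ ^ (2 * n) / (2 * n).factorial
  | 0 => by simp
  | K + 1 => by
    have ih := re_exp_partial θ K
    rw [show 2 * (K + 1) = 2 * K + 1 + 1 by ring, Finset.sum_range_succ, Finset.sum_range_succ, Finset.sum_range_succ,
      add_re, add_re, ih]
    have h1 : (((θ : ℂ) * I) ^ (2 * K) / (2 * K).factorial).re = (-1) ^ K * θ ^ (2 * K) / (2 * K).factorial := by
      have : ((θ : ℂ) * I) ^ (2 * K) / (2 * K).factorial = (((-1 : ℝ) ^ K * θ ^ (2 * K) / (2 * K).factorial : ℝ) : ℂ) := by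
        rw [mul_pow, pow_mul I, I_sq]; push_cast; ring
      rw [this, ofReal_re]
    have h2 : (((θ : ℂ) * I) ^ (2 * K + 1) / (2 * K + 1).factorial).re = 0 := by
      have : ((θ : ℂ) * I) ^ (2 * K + 1) / (2 * K + 1).factorial =
          (((-1 : ℝ) ^ K * θ ^ (2 * K + 1) / (2 * K + 1).factorial : ℝ) : ℂ) * I := by
        rw [pow_succ, mul_pow, pow_mul I, I_sq]; push_cast; ring
      rw [this, re_ofReal_mul, I_re, mul_zero]
    rw [h1, h2, add_zero]

/-- kernel: the cosine Taylor remainder bound `|cos θ − Σ_{n≤N} (−1)ⁿθ^{2n}/(2n)!| ≤ |θ|^{2N+2}` for `|θ| ≤ 1` (from Mathlib's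
`Complex.exp_bound`, taking real parts). [cite: BalabanImbrieJaffe1988, (3.16) p.267] -/
theorem cos_taylor_remainder {θ : ℝ} (hθ : |θ| ≤ 1) (N : ℕ) :
    |Real.cos θ - ∑ n ∈ Finset.range (N + 1), (-1) ^ n * θ ^ (2 * n) / (2 * n).factorial| ≤ |θ| ^ (2 * N + 2) := by
  have hnorm : ‖(θ : ℂ) * I‖ = |θ| := by simp
  have hx : ‖(θ : ℂ) * I‖ ≤ 1 := by rw [hnorm]; exact hθ
  have hn : 0 < 2 * (N + 1) := by omega
  have hb := Complex.exp_bound hx hn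
  have hre : Real.cos θ - ∑ n ∈ Finset.range (N + 1), (-1) ^ n * θ ^ (2 * n) / (2 * n).factorial =
      (exp ((θ : ℂ) * I) - ∑ m ∈ Finset.range (2 * (N + 1)), ((θ : ℂ) * I) ^ m / m.factorial).re := by
    rw [sub_re, exp_ofReal_mul_I_re, re_exp_partial]
  rw [hre]
  refine (abs_re_le_norm _).trans (hb.trans ?_)
  rw [hnorm, show 2 * (N + 1) = 2 * N + 2 by ring]
  have hfac : (((2 * N + 2).succ : ℕ) : ℝ) * ((((2 * N + 2).factorial : ℕ) : ℝ) * ((2 * N + 2 : ℕ) : ℝ))⁻¹ ≤ 1 := by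
    have hnat : (2 * N + 2).succ ≤ (2 * N + 2).factorial * (2 * N + 2) := by
      have := Nat.self_le_factorial (2 * N + 2)
      rw [Nat.succ_le_iff]
      nlinarith
    have hpos : (0 : ℝ) < (((2 * N + 2).factorial : ℕ) : ℝ) * ((2 * N + 2 : ℕ) : ℝ) := by positivity
    rw [← div_eq_mul_inv]
    exact div_le_one_of_le₀ (by exact_mod_cast hnat) hpos.le
  exact mul_le_of_le_one_right (pow_nonneg (abs_nonneg θ) _) hfac

/-- kernel: the corrected remainder IS minus `e₀⁻²` times the cosine Taylor remainder of order `n̄ = 2·nhalf` at `θ = e₀f` (for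
`nhalf ≥ 1`, `e₀ ≠ 0`). [cite: BalabanImbrieJaffe1988, (3.16) p.267] -/
theorem W0corr_eq {e₀ : ℝ} (he : e₀ ≠ 0) {nhalf : ℕ} (hN : 1 ≤ nhalf) (f : ℝ) :
    W0corr e₀ nhalf f = -(e₀⁻¹ ^ 2) *
      (Real.cos (e₀ * f) - ∑ n ∈ Finset.range (nhalf + 1), (-1) ^ n * (e₀ * f) ^ (2 * n) / (2 * n).factorial) := by
  obtain ⟨M, rfl⟩ : ∃ M, nhalf = M + 1 := ⟨nhalf - 1, by omega⟩
  have hsplit : ∑ n ∈ Finset.range (M + 1 + 1), (-1 : ℝ) ^ n * (e₀ * f) ^ (2 * n) / (2 * n).factorial =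
      1 - (e₀ * f) ^ 2 / 2 + ∑ k ∈ Finset.range M, (-1 : ℝ) ^ (k + 2) * (e₀ * f) ^ (2 * (k + 2)) / (2 * (k + 2)).factorial := by
    rw [Finset.sum_range_succ', Finset.sum_range_succ']
    simp [Nat.factorial]
    ring
  have hV : V0corr e₀ (M + 1) f =
      ∑ k ∈ Finset.range M, (-1 : ℝ) ^ (k + 3) * e₀ ^ (2 * k + 2) * f ^ (2 * k + 4) / (2 * (k + 2)).factorial := by
    unfold V0corr
    rw [← Finset.Ico_succ_right_eq_Icc, Order.succ_eq_add_one, Finset.sum_Ico_eq_sum_range, show M + 1 + 1 - 2 = M by omega]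
    refine Finset.sum_congr rfl fun k _ => ?_
    rw [show 2 + k + 1 = k + 3 by ring, show 2 * (2 + k) - 2 = 2 * k + 2 by omega, show 2 * (2 + k) = 2 * k + 4 by ring,
      show 2 * (k + 2) = 2 * k + 4 by ring]
  have hsum : ∑ k ∈ Finset.range M, (-1 : ℝ) ^ (k + 3) * e₀ ^ (2 * k + 2) * f ^ (2 * k + 4) / (2 * (k + 2)).factorial =
      -(e₀⁻¹ ^ 2) * ∑ k ∈ Finset.range M, (-1 : ℝ) ^ (k + 2) * (e₀ * f) ^ (2 * (k + 2)) / (2 * (k + 2)).factorial := by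
    rw [Finset.mul_sum]
    refine Finset.sum_congr rfl fun k _ => ?_
    rw [show 2 * (k + 2) = 2 * k + 4 by ring, mul_pow, pow_succ (-1 : ℝ) (k + 2)]
    field_simp
    ring
  rw [W0corr, hsplit, hV, hsum]
  field_simp
  ring

/-- kernel, the p. 267 claim with the corrected sign: *"the remainder is called 'irrelevant' because it is bounded by ce₀^{n̄}p(e₀)^{n̄+2}"* —
here with `c = 1`: for `n̄ = 2·nhalf ≥ 2`, `e₀ > 0` and `e₀|f| ≤ 1`, `|W₀^{corr}| ≤ e₀^{n̄}|f|^{n̄+2}`. [cite: BalabanImbrieJaffe1988, (3.16) p.267] -/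
theorem abs_W0corr_le {e₀ f : ℝ} (he : 0 < e₀) {nhalf : ℕ} (hN : 1 ≤ nhalf) (hθ : e₀ * |f| ≤ 1) :
    |W0corr e₀ nhalf f| ≤ e₀ ^ (2 * nhalf) * |f| ^ (2 * nhalf + 2) := by
  have hθ' : |e₀ * f| ≤ 1 := by rwa [abs_mul, abs_of_pos he]
  have hR := cos_taylor_remainder hθ' nhalf
  rw [W0corr_eq he.ne' hN, abs_mul, abs_neg, abs_of_pos (by positivity : (0 : ℝ) < e₀⁻¹ ^ 2)]
  calc e₀⁻¹ ^ 2 * |Real.cos (e₀ * f) - ∑ n ∈ Finset.range (nhalf + 1), (-1) ^ n * (e₀ * f) ^ (2 * n) / (2 * n).factorial|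
      ≤ e₀⁻¹ ^ 2 * |e₀ * f| ^ (2 * nhalf + 2) := by gcongr
    _ = e₀ ^ (2 * nhalf) * |f| ^ (2 * nhalf + 2) := by
      rw [abs_mul, abs_of_pos he, mul_pow, show 2 * nhalf + 2 = 2 * nhalf + 1 + 1 by ring, pow_succ, pow_succ]
      field_simp
      ring

/-- kernel, in the paper's letters: under the small-field condition `|f^{(0)}(p)| ≤ p(e₀)` of (3.15) and `e₀p(e₀) ≤ 1`,
`|W₀^{corr}(p)| ≤ e₀^{n̄}p(e₀)^{n̄+2}` (`n̄ = 2·nhalf`). [cite: BalabanImbrieJaffe1988, (3.16) p.267] -/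
theorem abs_W0corr_le_printed {e₀ f pe₀ : ℝ} (he : 0 < e₀) {nhalf : ℕ} (hN : 1 ≤ nhalf) (hf : |f| ≤ pe₀) (hp : e₀ * pe₀ ≤ 1) :
    |W0corr e₀ nhalf f| ≤ e₀ ^ (2 * nhalf) * pe₀ ^ (2 * nhalf + 2) := by
  have hθ : e₀ * |f| ≤ 1 := (mul_le_mul_of_nonneg_left hf he.le).trans hp
  refine (abs_W0corr_le he hN hθ).trans ?_
  gcongr

/-! ## v1.3 (append-only): the CHARGE reading of `e^{n̄β}` in (3.34) — reading note GAPS G-C2-p36-04 (p36 gen 4; §3 owner concurs)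

p. 270 prints *"|W₃^{(0)}(□)| ≦ e^{n̄β}(ε/ε₀)^κ. (3.34) Here β > 0 is a fixed small power, κ > d is a fixed large power"* and
p. 273 *"ε₀ = min{1, (8λ/e²)^{1/2}}e^β, with β > 0 small and e ≪ 1"*; p. 298 *"each vertex results in at least a factor
e^β(L^kε/ε₀)^{1/4−α}"*.  In all three places `e` is the CHARGE of the model (a "power" β of the small coupling e), exactly as
`BIJ88Sect4Statements.eps0 lam e β := min 1 √(8λ/e²) * e ^ β` reads it; `Ineq334` above reads Euler's number (`Real.exp (n̄β)`).
Since 0 < e ≤ 1 gives e^{n̄β} ≤ 1 ≤ exp(n̄β), the typed `Ineq334` is implied by the printed bound (nothing typed is false; the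
p. 298 chain yields it at level k: `BIJ88W3Chain298.ineq334_of_chain`).  The primed statement below carries the charge explicitly;
`BIJ88W3Chain298.ineqW3_chain` inhabits it at level k (s = L^kε/ε₀) term for term.  No declaration above is modified. -/

/-- **(3.34), charge reading** p. 270 [PDF 14]: *"|W₃^{(0)}(□)| ≦ e^{n̄β}(ε/ε₀)^κ"* with `e` = the charge (0 < e ≪ 1, p. 273) and
β > 0 *"a fixed small power"*, κ > d: for every r(e₀)-cube □, `|W₃(□)| ≤ e ^ (n̄β) · (ε/ε₀) ^ κ`.  TRANSCRIPTION NOTE: this is the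
reading of record of the letter `e` in (3.34) (GAPS G-C2-p36-04); `Ineq334` (Euler's e) is the weaker shape, see
`Ineq334c.toIneq334`. [cite: BalabanImbrieJaffe1988, (3.34) p.270] -/
def Ineq334c {Cube : Type*} (nbar : ℕ) (β e ε ε₀ κ : ℝ) (W₃ : Cube → ℝ) : Prop :=
  ∀ q : Cube, |W₃ q| ≤ e ^ ((nbar : ℝ) * β) * (ε / ε₀) ^ κ

/-- In the charge reading the prefactor is SMALL: `e ^ (n̄β) ≤ 1` for 0 ≤ e ≤ 1 and β ≥ 0.
[cite: BalabanImbrieJaffe1988, (3.34) p.270] -/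
theorem charge_rpow_le_one {e β : ℝ} (nbar : ℕ) (he0 : 0 ≤ e) (he1 : e ≤ 1) (hβ : 0 ≤ β) :
    e ^ ((nbar : ℝ) * β) ≤ 1 :=
  Real.rpow_le_one he0 he1 (by positivity)

/-- The charge reading implies the typed `Real.exp` reading: for 0 ≤ e ≤ 1, β ≥ 0 and ε/ε₀ ≥ 0,
`Ineq334c n̄ β e ε ε₀ κ W₃ → Ineq334 n̄ β ε ε₀ κ W₃` (e^{n̄β} ≤ 1 ≤ exp(n̄β)). [cite: BalabanImbrieJaffe1988, (3.34) p.270] -/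
theorem Ineq334c.toIneq334 {Cube : Type*} {nbar : ℕ} {β e ε ε₀ κ : ℝ} {W₃ : Cube → ℝ}
    (h : Ineq334c nbar β e ε ε₀ κ W₃) (he0 : 0 ≤ e) (he1 : e ≤ 1) (hβ : 0 ≤ β) (hr : 0 ≤ ε / ε₀) :
    Ineq334 nbar β ε ε₀ κ W₃ := by
  intro q
  refine (h q).trans (mul_le_mul_of_nonneg_right ?_ (Real.rpow_nonneg hr κ))
  exact (charge_rpow_le_one nbar he0 he1 hβ).trans (Real.one_le_exp (by positivity))

/-- Under the stopping rule of p. 273 (`L^kε < ε₀`, here abstractly `ε < ε₀` with `0 ≤ ε`) the ratio hypothesis of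
`Ineq334c.toIneq334` holds, so at every level reached by the induction the charge reading implies the typed one.
[cite: BalabanImbrieJaffe1988, (3.34) p.270] -/
theorem Ineq334c.toIneq334_of_lt {Cube : Type*} {nbar : ℕ} {β e ε ε₀ κ : ℝ} {W₃ : Cube → ℝ}
    (h : Ineq334c nbar β e ε ε₀ κ W₃) (he0 : 0 ≤ e) (he1 : e ≤ 1) (hβ : 0 ≤ β) (hε : 0 ≤ ε) (hstop : ε < ε₀) :
    Ineq334 nbar β ε ε₀ κ W₃ :=
  h.toIneq334 he0 he1 hβ (div_nonneg hε (hε.trans hstop.le))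

end

end Literature.MathematicalPhysics.QuantumFieldTheory.BalabanImbrieJaffe1984to88.BIJ88Sect3Statements
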